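import Mathlib
import Literature.Analysis.FluidPDE.PineauVicolRSS
import Literature.Analysis.FluidPDE.AxisymmetricEuler
import Literature.Analysis.FluidPDE.SwirlTransportProofs
import Literature.Analysis.FluidPDE.TsaiSelfSimilarBounded

/-! # RUNG FILE for crux idea «alpha-m-shift» (stmt-NavierStokesRegularity-22676, `CoriolisHead.NoCoRotatingCore`)

**This is NOT a line**: no composition to the crux is claimed.  It types the RUNGS of the residual
R1 (Pineau–Vicol Conjecture 1.1, profile form = hypothesis `hPV` of
`Theorems.CoriolisHead.decayingRotatedLiouville_of_pineauVicolFrame`) suggested by the observation that the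
rotation rate `α` enters the rotated Leray profile system only through the products `α·m` over the active
azimuthal modes `m` (`R = −∂_θ` on cylindrical components, PV 2026 Lemma 6.1):

* `RungTop` (k = ∞, PROVED here): an AXISYMMETRIC profile in the Pineau–Vicol frame `(ν,a,B) = (1,½,αJ)` with
  Type-I decay is `0`, for EVERY `α` — the rotation term `α(JU − (Jy·∇)U)` vanishes identically
  (`IsAxisymmetric.fderiv_rotGen`), so `U` is a bounded Leray profile and Tsai's theorem
  (`IsLerayProfile.exists_eq_const_of_bounded`) applies.  (PV 2026 p. 17: `ker R` = axisymmetric fields.)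
* `KFoldExtremeRotationPV` (RUNG K(k), OPEN, typed): k-fold symmetric profiles vanish once `k·|α| ≥ A(K)`;
  mechanism = the k-fold Wirtinger constant `‖(V)_a‖_{L²_μ} ≤ (2/k)‖RV‖_{L²_μ}` inside PV (6.19)/(6.11) and the
  fact that PV §6.5 uses only `|α| ‖RU‖_{L²_μ} ≤ ε` [arXiv:2607.09619, (6.9), (6.11), (6.17)–(6.21), §6.5].
  k = 1 is PV Thm 1.4 (ii) transported to the profile frame; `RungTop` is its k → ∞ limit.

No summit, crux or residual is proved by this file; R1 / 22676 / NS regularity remain OPEN. -/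

open Set Function Literature.Analysis.FluidPDE Literature.Analysis.FluidPDE.VectorCalculus

set_option linter.dupNamespace false

namespace Summit.NavierStokesRegularity.NavierStokesRegularity.Cruxes.NoCoRotatingCore.AlphaMShift

local notation "ℝ³" => EuclideanSpace ℝ (Fin 3)

/-- The Pineau–Vicol-frame rotated Leray profile system at rate `α` (shape of the hypothesis `hPV` of
`Theorems.CoriolisHead.decayingRotatedLiouville_of_pineauVicolFrame`, verbatim). -/
def IsPVProfile (α : ℝ) (U : ℝ³ → ℝ³) (P : ℝ³ → ℝ) : Prop :=
  ContDiff ℝ (⊤ : ℕ∞) U ∧ ContDiff ℝ 2 P ∧ IsDivFree U ∧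
    ∀ y, α • (rotGen (U y) - fderiv ℝ U y (rotGen y)) + (1 / 2 : ℝ) • U y
      + (1 / 2 : ℝ) • fderiv ℝ U y y - Laplacian.laplacian U y
      + Literature.Analysis.FluidPDE.convect U U y + gradient P y = 0

/-- Type-I decay of a profile, `|U(y)| ≤ K/(1+|y|)` (PV 2026 (1.9)). -/
def HasPVDecay (U : ℝ³ → ℝ³) : Prop := ∃ K : ℝ, ∀ y, ‖U y‖ ≤ K / (1 + ‖y‖)

/-- A decaying constant field is zero. -/
theorem const_eq_zero_of_decay {c : ℝ³} {K : ℝ} (h : ∀ y : ℝ³, ‖c‖ ≤ K / (1 + ‖y‖)) : c = 0 := by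
  by_contra hc
  have hcpos : 0 < ‖c‖ := norm_pos_iff.mpr hc
  -- test the decay at `y = n • e₀` with `n` large
  obtain ⟨n, hn⟩ := exists_nat_gt (K / ‖c‖)
  set y : ℝ³ := (n : ℝ) • EuclideanSpace.single (0 : Fin 3) (1 : ℝ) with hy
  have hny : ‖y‖ = n := by
    rw [hy, norm_smul, PiLp.norm_single, norm_one, mul_one, Real.norm_eq_abs,
      abs_of_nonneg (Nat.cast_nonneg n)]
  have h1 := h y
  rw [hny] at h1
  have hpos : (0 : ℝ) < 1 + n := by positivity
  rw [le_div_iff₀ hpos] at h1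
  have h2 : K / ‖c‖ < 1 + (n : ℝ) := by linarith
  rw [div_lt_iff₀ hcpos] at h2
  nlinarith

/-- **RUNG TOP (k = ∞): axisymmetric rotated self-similar profiles are trivial, for every rotation rate.**
If `U` is axisymmetric about the rotation axis, the rotation term vanishes pointwise
(`IsAxisymmetric.fderiv_rotGen`), `U` is a Leray profile with `(ν, a) = (1, ½)`, bounded by its Type-I
decay, hence constant by Tsai's theorem (`IsLerayProfile.exists_eq_const_of_bounded`) and `0` by decay.
[cite: PineauVicol2026 p. 17 (ker R); Tsai1998 Thm 1] -/
theorem rungTop_axisymmetric (α : ℝ) (U : ℝ³ → ℝ³) (P : ℝ³ → ℝ)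
    (hprof : IsPVProfile α U P) (hdec : HasPVDecay U) (hax : IsAxisymmetric U) :
    ∀ y, U y = 0 := by
  obtain ⟨hU, hP, hdiv, heq⟩ := hprof
  obtain ⟨K, hK⟩ := hdec
  -- the rotation term vanishes
  have hrot : ∀ y, rotGen (U y) - fderiv ℝ U y (rotGen y) = 0 := fun y => by
    rw [hax.fderiv_rotGen ((hU.differentiable (by simp)).differentiableAt), sub_self]
  -- hence `U` is a Leray profile with `ν = 1`, `a = ½`
  have hler : IsLerayProfile 1 (1 / 2 : ℝ) U P := by
    refine ⟨hU.of_le (by norm_cast), hP.of_le (by norm_num), fun y => ?_, hdiv⟩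
    have e := heq y
    rw [hrot y, smul_zero, zero_add, one_smul] at *
    -- `½U + ½(y·∇)U − ΔU + (U·∇)U + ∇P = 0`  ↔  `−ΔU + ½U + ½(y·∇)U + (U·∇)U + ∇P = 0`
    have : -(Laplacian.laplacian U y) + (1 / 2 : ℝ) • U y + (1 / 2 : ℝ) • fderiv ℝ U y y
        + Literature.Analysis.FluidPDE.convect U U y + gradient P y
        = (1 / 2 : ℝ) • U y + (1 / 2 : ℝ) • fderiv ℝ U y y - Laplacian.laplacian U y
        + Literature.Analysis.FluidPDE.convect U U y + gradient P y := by abel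
    rw [this]; exact e
  -- bounded by the decay
  have hbdd : ∃ M : ℝ, ∀ y, ‖U y‖ ≤ M := ⟨|K|, fun y => (hK y).trans (by
    calc K / (1 + ‖y‖) ≤ |K| / (1 + ‖y‖) := by gcongr; exact le_abs_self K
      _ ≤ |K| := div_le_self (abs_nonneg K) (by linarith [norm_nonneg y]))⟩
  obtain ⟨c, hc⟩ := hler.exists_eq_const_of_bounded one_pos (by norm_num) hbdd
  have hc0 : c = 0 := const_eq_zero_of_decay (K := K) (fun y => by rw [← hc y]; exact hK y)
  intro y; rw [hc y, hc0]

/-- k-fold rotational symmetry about the rotation axis (order `k ≥ 1`). -/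
def IsKFoldSymmetric (k : ℕ) (U : ℝ³ → ℝ³) : Prop :=
  ∀ y, U (rotZ (2 * Real.pi / k) y) = rotZ (2 * Real.pi / k) (U y)

/-- **RUNG K(k) (OPEN, typed; profile frame).**  For every decay constant `K` there is a threshold `A`
such that a k-fold symmetric Pineau–Vicol profile at rate `α` with `k·|α| ≥ A` vanishes.  k = 1 is
PV 2026 Thm 1.4 (ii)/Prop. 6.5 in the profile frame; the conjectured gain `A(k) = A(1)/k` comes from the
k-fold Wirtinger inequality in (6.19) and (6.11) [arXiv:2607.09619 §6].  Why it might fail: the ε-split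
constant `C_ε` of (6.11) must be checked to be symmetry-agnostic line by line (it is built from the Type-I
bounds (1.9), (2.1) only, p. 20–21). -/
def KFoldExtremeRotationPV : Prop :=
  ∀ K : ℝ, 0 < K → ∃ A : ℝ, 0 < A ∧
    ∀ (k : ℕ) (α : ℝ) (U : ℝ³ → ℝ³) (P : ℝ³ → ℝ), 1 ≤ k →
      IsPVProfile α U P → (∀ y, ‖U y‖ ≤ K / (1 + ‖y‖)) → IsKFoldSymmetric k U →
      A ≤ k * |α| → ∀ y, U y = 0

/-- Consistency: an axisymmetric profile is k-fold symmetric for every k, and for it RUNG K(k) holds with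
ANY threshold — this is `rungTop_axisymmetric` (the k → ∞ end of the ladder is already a theorem). -/
theorem kFold_of_axisymmetric (k : ℕ) (α : ℝ) (U : ℝ³ → ℝ³) (P : ℝ³ → ℝ)
    (hprof : IsPVProfile α U P) (hdec : HasPVDecay U) (hax : IsAxisymmetric U) :
    IsKFoldSymmetric k U ∧ ∀ y, U y = 0 :=
  ⟨fun y => hax _ y, rungTop_axisymmetric α U P hprof hdec hax⟩

/-- R1 in the profile frame (= hypothesis `hPV` of `decayingRotatedLiouville_of_pineauVicolFrame`, all `α`;
`α = 0` is Tsai) implies every rung, trivially.  Recorded so that the direction of the ladder is unambiguous: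
the rungs FENCE the window `α₁ < |α| < α₂` (a putative profile has symmetry order `k < A/|α|`), they do not
close it. -/
theorem kFoldExtremeRotationPV_of_R1
    (hR1 : ∀ (α : ℝ) (U : ℝ³ → ℝ³) (P : ℝ³ → ℝ), IsPVProfile α U P → HasPVDecay U → ∀ y, U y = 0) :
    KFoldExtremeRotationPV :=
  fun K _ => ⟨1, one_pos, fun _k α U P _ hprof hdec _ _ => hR1 α U P hprof ⟨K, hdec⟩⟩

end Summit.NavierStokesRegularity.NavierStokesRegularity.Cruxes.NoCoRotatingCore.AlphaMShift
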